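import Literature.MathematicalPhysics.QuantumFieldTheory.Balaban1983to89.B11Eq56SeriesConcrete
import Literature.MathematicalPhysics.QuantumFieldTheory.Balaban1983to89.B11Eq56Order3Concrete
import Literature.MathematicalPhysics.QuantumFieldTheory.Balaban1983to89.B11Eq56Coefficients

/-!
# `Balaban1983to89.B11Eq56ThirdTermConcrete` — T. Bałaban, *The variational problem and background fields in renormalization group method
for lattice gauge theories*, Commun. Math. Phys. **102** (1985) 277–309 [Balaban1985Variational], (56) p. 286: **«D^{(3)}(A′) = C_j^{(3)}(LʲηA′) −
2C_j^{(2)}(LʲηA′, LʲηHC^{(2)}(A′))» AS AN IDENTITY OF TAYLOR TERMS FOR THE CONCRETE FIXED POINT `D̃` OF (49) BUILT ON THE REMAINDER `C_j(U₀, ·)`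
OF [4] ON THE `ℤᵈ` CARRIER** — the homogeneous term of order three `D̃⁽³⁾(A′) = (3!)⁻¹(d³/dt³)D̃(tA′)|₀` of `B11Eq56SeriesConcrete` IS r08's printed
third-order term `D3 C2map C3map H A′ = C3map A′ A′ A′ − 2•C2map A′ (H(C2map A′ A′))` for EVERY `A′ ∈ 𝔸^S` (and `D̃⁽²⁾(A′) = C2map A′ A′` for every
`A′`, extending the gen-6 `DtN_two` off the ball by homogeneity); the terms of ANY power series of `D̃` at `0` on the diagonal are the `D̃⁽ⁿ⁾`;
and (56) with its two printed terms separated: `D̃(A′) = C⁽²⁾(A′) + D⁽³⁾(A′) + Σ_{n≥4} D̃⁽ⁿ⁾(A′)` with the geometric tail bound on the whole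
ball (51)

statement-level skeleton of published theorems with citation tags; proofs where landed; nothing here is a claim about the Yang–Mills mass gap

v1.1 (p06 gen 8, 2026-08-21): DOCFIX ONLY — the four guillemet quotations of p. 286 now carry the printed subscripts `j` (C_j^{(2)}, C_j^{(3)})
and the printed words «For example we have on Λ_j …»; declarations byte-identical to v1 (p303626).

PDF held: `paper:balaban1985-cmp102-variational-background` (journal page = PDF page + 276); p. 286 [PDF 10], text layer `p0010.txt` and the
render `run/shared/lean/pub/pub-balaban/b2b-balaban-ref1/pages/1985-cmp102-variational-background/…-p010-x2.png` (re-read by this seat);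
[4] = `paper:balaban1985-cmp98-averaging`, (136) p. 39.

CITATION HEADER / WHAT IS REPRODUCED.  Cell `lit-balaban`, Phase-2 proof seat p06 gen 7 = unit `lit-balaban-p06` (TAKING line HOME/STATUS.md
2026-08-21, gen 7; the successor item (o) of HANDOFF.md § lit-balaban-p06 GEN 6); SKELETON row **B11.Eq55** ((55)–(56); owner r08,
HOME/lit-balaban-r08/ROWS-B11.md: (56) proved abstractly p250185 `B11Eq56Expansion.eq56_order3(_fixedPoint)` as a QUARTIC-REMAINDER estimate,
concretely p292768 `B11Eq56Order3Concrete.eq56_order3_concrete`; the series (56) itself p294497 `B11Eq56SeriesConcrete.hasSum_DtN` with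
`DtN_two`; the power-series bridge p297698 `B11Eq56Coefficients`).  THIS FILE closes the order-three clause of (56) AS PRINTED — an identity
between the third homogeneous term of the expansion of `D` and the displayed polynomial — for the concrete `D̃`.  THE PRINT (p. 286; render `…-p010-x2.png` re-read, v1.1
re-quotation with the subscripts j as printed — ref-1 g42 nit 2026-08-21T22:02Z): *«From Eq. (56) a sequence of recursive equations for D^{(n)}
follows. It can be solved easily. For example we have on Λ_j  D^{(2)}(A′) = C_j^{(2)}(LʲηA′), D^{(3)}(A′) = C_j^{(3)}(LʲηA′) − 2C_j^{(2)}(LʲηA′,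
LʲηHC^{(2)}(A′)), and so on. Here C_j^{(2)}(A′, A″) denotes a symmetric bilinear form obtained by polarization from the quadratic form C_j^{(2)}(A),
and C^{(2)}(A′) = C_j^{(2)}(LʲηA′) on Λ_j.»*, after *«C_j(LʲηA′ − LʲηHD(A′)) = Σ_{n=2}^∞ C_j^{(n)}(LʲηA′ − LʲηH
Σ_{m=2}^∞ D^{(m)}(A′)) = Σ_{n=2}^∞ D^{(n)}(A′), (56) where C_j^{(n)}, D^{(n)} are homogeneous polynomials of n-th order»*.

DICTIONARY (as `B11Eq56SeriesConcrete` / `B11Eq56Order3Concrete`: tree units, scales absorbed, sup norms).  `𝒴 = 𝔸^S ∋ A′`, `𝒳 = 𝔸^T`;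
`Cmap a = (C_j(U₀, ins_S a)(c))_{c∈T}`; `H ↦ hop : 𝔸^T →ₗ[ℂ] 𝔸^S`, `‖hop X‖ ≤ B₀‖X‖` ((46)); `D ↦ D̃ = Dt`, ANY map with the fixed-point
characterization (49) + (55)-ball on `‖A′‖ < ε` (hypotheses `hDfix`, `hDball`, inhabited by `B12SecondOrder267Concrete.exists_Dt_concrete`);
`D^{(n)}(A′) ↦ DtN Dt A′ n` (the `tⁿ`-coefficient of the slice `t ↦ D̃(tA′)`); `C^{(2)}(LʲηA′, ·)` ↦ `C2map L U₀ S T j A′` (symmetric, gen 5),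
`C^{(3)}(LʲηA′)` ↦ `C3map L U₀ S T j A′ A′ A′` (gen 6); the printed `D^{(3)}` ↦ r08's `B11Eq56Expansion.D3 (C2map …) (C3map …) hop A′`; print's
`C₂` ↦ `C₂(Lʲ)²` with `C₂ = 8·C₁·e^{4cα₀}` (written out; no notation in this file), `ε₃ ↦ ε`.  Regime = `B11Eq44Concrete`'s (regular
background, witness radius `b`, [4] smallness incl. (145)/(155), `j ≤ k`) with «9C₂B₀ε₃ < 1» ((54)) and `3ε ≤ b`.

WHAT THIS FILE PROVES (theorems only; kernel, 0 sorry, standard axioms), for `j ≤ k` and `D̃` as above: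
* §0 `D3_smul` (r08's printed `D^{(3)}` is homogeneous of order three), a private limit lemma.
* §1 **`DtN_three_of_norm_lt`** (`D̃⁽³⁾(A′) = D3 C2map C3map H A′` on `‖A′‖ < ε`: along the ray `tA′`, `t ↓ 0`, both `t²C⁽²⁾(A′) + t³D̃⁽³⁾(A′)`
  (the series (56): tail `O(t⁴)` by `norm_Dt_sub_partialSum_le`, order two by `DtN_two`) and `t²C⁽²⁾(A′) + t³D3(A′)` (`eq56_order3_concrete` at
  `tA′`, homogeneity) approximate `D̃(tA′)` to fourth order), **`DtN_three`** (EVERY `A′ ∈ 𝔸^S`, by 3-homogeneity of both sides), `DtN_three_eq`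
  (the printed words `C3map A′ A′ A′ − 2•C2map A′ (H(C2map A′ A′))`), **`DtN_two_all`** (`D̃⁽²⁾(A′) = C2map A′ A′` for every `A′`, by 2-homogeneity).
* §2 **THE TERMS OF ANY POWER SERIES OF `D̃` ARE THE `D̃⁽ⁿ⁾`**: `powerSeries_Dt_diag_eq_DtN` (no regime), `powerSeries_Dt_diag_three`,
  **`p267_powerSeries_terms₃`** (∃ a power series of `D̃` at `0` with `p₀ = p₁ = 0`, `p₂ = C⁽²⁾`, `p₃ = D⁽³⁾` on the diagonal, `p_n = D̃⁽ⁿ⁾`).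
* §3 **(56) WITH ITS TWO PRINTED TERMS SEPARATED**: `sum_range_four_DtN`, **`norm_Dt_sub_D2_sub_D3_le`** (`‖D̃(A′) − C⁽²⁾(A′) − D⁽³⁾(A′)‖ ≤
  4C₂(Lʲ)²ε²(‖A′‖/ε)⁴(1 − ‖A′‖/ε)⁻¹` on the whole ball (51)), **`hasSum_DtN_from_four`** (`Σ_{n≥4} D̃⁽ⁿ⁾(A′) = D̃(A′) − C⁽²⁾(A′) − D⁽³⁾(A′)`).
NOT CLAIMED: closed forms of `D^{(n)}`, `n ≥ 4` («and so on» is not printed beyond order three), the operator `H` itself ((45)–(46) = [5] Thm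
3.12, abstract here), the side condition «X = 0 on Λ₀» of (51), anything about scales `Λ_j`.  NOT summit progress.
-/

noncomputable section

open scoped BigOperators Topology
open NormedSpace Finset Metric Filter

namespace Literature.MathematicalPhysics.QuantumFieldTheory.Balaban1983to89.B11Eq56ThirdTermConcrete

open B7Prop1Explicit B7Prop1Local B7Prop2Explicit B7Prop3Flat B7Prop4Flat B7Eq92Concrete B7Prop3GeneralLinear
  B7Prop4GeneralLevels B7Prop5GeneralLevels B7Eq136SecondOrder B13Contraction113 B11Eq56Expansion B11Eq44Concrete
  B12SecondOrder267Concrete B11Eq56Order3Concrete B11Eq56SeriesConcrete B11Eq56Coefficients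

-- `Site` alone would resolve to the torus sites of `Setup.lean`; re-export the `ℤ^d` sites of `B7Prop1Explicit`.
export B7Prop1Explicit (Site)

variable {d : ℕ}

/-! ## §0 Homogeneity of the printed `D^{(3)}`; a limit lemma -/

section Generic

variable {𝒳 𝒴 : Type*} [NormedAddCommGroup 𝒳] [NormedSpace ℂ 𝒳] [NormedAddCommGroup 𝒴] [NormedSpace ℂ 𝒴]

/-- **r08's printed third-order term is homogeneous of order three**: `D3 C2 C3 H (s·A′) = s³·D3 C2 C3 H A′` for every `s ∈ ℂ` («D^{(n)} are
homogeneous polynomials of n-th order»; `C3` trilinear, `C2` bilinear, `H` linear). [cite: Balaban1985Variational, (56) p.286] -/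
theorem D3_smul (C2 : 𝒴 →ₗ[ℂ] 𝒴 →ₗ[ℂ] 𝒳) (C3 : 𝒴 →ₗ[ℂ] 𝒴 →ₗ[ℂ] 𝒴 →ₗ[ℂ] 𝒳) (Hop : 𝒳 →ₗ[ℂ] 𝒴) (s : ℂ) (A' : 𝒴) :
    D3 C2 C3 Hop (s • A') = s ^ 3 • D3 C2 C3 Hop A' := by
  simp only [D3_def, map_smul, LinearMap.smul_apply, smul_sub, smul_smul, ← Nat.cast_smul_eq_nsmul ℂ]
  ring_nf

/-- a vector `E` with `tᵐ‖E‖ ≤ K·tᵐ⁺¹` for all real `0 < t ≤ ½` vanishes. [folklore] -/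
private theorem eq_zero_of_pow_mul_norm_le {F : Type*} [NormedAddCommGroup F] {E : F} {K : ℝ} (m : ℕ)
    (h : ∀ t : ℝ, 0 < t → t ≤ 1 / 2 → t ^ m * ‖E‖ ≤ K * t ^ (m + 1)) : E = 0 := by
  have hE0 : ‖E‖ ≤ 0 := by
    refine le_of_forall_pos_le_add fun δ hδ => ?_
    rw [zero_add]
    have hKp : 0 < |K| + 1 := by positivity
    obtain ⟨t, ht0, ht1, ht2⟩ : ∃ t : ℝ, 0 < t ∧ t ≤ 1 / 2 ∧ t ≤ δ / (|K| + 1) :=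
      ⟨min (1 / 2) (δ / (|K| + 1)), lt_min (by norm_num) (div_pos hδ hKp), min_le_left _ _, min_le_right _ _⟩
    have hk := h t ht0 ht1
    have hE1 : ‖E‖ ≤ K * t := by
      have h' : t ^ m * ‖E‖ ≤ t ^ m * (K * t) := by
        rw [show t ^ m * (K * t) = K * t ^ (m + 1) by ring]; exact hk
      exact le_of_mul_le_mul_left h' (by positivity)
    have hE2 : ‖E‖ ≤ (|K| + 1) * t :=
      hE1.trans (mul_le_mul_of_nonneg_right (by linarith [le_abs_self K]) ht0.le)
    calc ‖E‖ ≤ (|K| + 1) * t := hE2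
      _ ≤ (|K| + 1) * (δ / (|K| + 1)) := mul_le_mul_of_nonneg_left ht2 hKp.le
      _ = δ := by field_simp
  exact norm_le_zero_iff.mp hE0

end Generic

/-! ## §1 `D̃⁽³⁾ = D^{(3)}` as printed, for the concrete `D̃` -/

section Regime

variable {𝔸 : Type*} [NormedRing 𝔸] [NormedAlgebra ℂ 𝔸] [CompleteSpace 𝔸] [NormOneClass 𝔸]

variable (L : ℕ) (hL : 2 ≤ L) {G : Subgroup 𝔸ˣ} (hG : AvgClosed d L G) (k : ℕ)
  (U₀ : Site d → Fin d → 𝔸ˣ) (hU₀ : ∀ x κ, U₀ x κ ∈ G) {α₀ : ℝ} (hα : 0 < α₀)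
  (hα3 : C0 d * α₀ ≤ 1 / 3) (hα4 : 4 * α₀ ≤ c2' d L) (h52 : pdev U₀ < α₀ * (((L : ℝ) ^ k)⁻¹) ^ 2)
  {b : ℝ} (hb : 0 < b)
  (hsmall : Real.exp (4 * (800 * ((d : ℝ) + 1) ^ 2 * ((d : ℝ) + 4)) * α₀)
    * (1 + 8 * (131072 * ((d : ℝ) + 1) ^ 2) * ((L : ℝ) ^ k * b)) ≤ 2)
  (hc₃ : 4 * ((L : ℝ) ^ k * b) < c3 d L)
  (h145 : 8 * d * thetaGen d L α₀ * (L : ℝ)⁻¹ ^ 4 ≤ 1)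
  (h155 : (2 * (L : ℝ) - 1) * (L : ℝ)⁻¹ ^ 2 + 2 * d * thetaGen d L α₀ * (L : ℝ)⁻¹ ^ 3
    + 1 / 8 * (1 + 2 * d * thetaGen d L α₀ * (L : ℝ)⁻¹ ^ 2 + 2 * d * C3Gen d L * ((L : ℝ) ^ k * b)) * (L : ℝ)⁻¹ ^ 2 ≤ 1)
  (S T : Finset (Site d × Fin d)) (hop : (T → 𝔸) →ₗ[ℂ] (S → 𝔸)) {B₀ ε : ℝ} {Dt : (S → 𝔸) → (T → 𝔸)}

include hL hG hU₀ hα hα3 hα4 h52 hb hsmall hc₃ h145 h155 in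
/-- **`D̃⁽³⁾(A′) = D^{(3)}(A′)` ON THE BALL (51)** — (56) «D^{(3)}(A′) = C_j^{(3)}(LʲηA′) − 2C_j^{(2)}(LʲηA′, LʲηHC^{(2)}(A′))» as the equality of the
THIRD TAYLOR TERM of the concrete `D̃` with r08's printed polynomial `D3 C2map C3map H`: along the ray `tA′`, `t ↓ 0`, `t²C⁽²⁾(A′) + t³D̃⁽³⁾(A′)`
(series (56), tail `O(t⁴)`) and `t²C⁽²⁾(A′) + t³D3(A′)` (`eq56_order3_concrete` at `tA′`) both approximate `D̃(tA′)` to fourth order.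
[cite: Balaban1985Variational, (56) p.286] [cite: Balaban1985Averaging, (136) p.39] -/
theorem DtN_three_of_norm_lt {j : ℕ} (hj : j ≤ k) (hB₀ : 0 ≤ B₀) (hHop : ∀ X, ‖hop X‖ ≤ B₀ * ‖X‖)
    (hq : 9 * ((8 * (131072 * ((d : ℝ) + 1) ^ 2) * Real.exp (4 * (800 * ((d : ℝ) + 1) ^ 2 * ((d : ℝ) + 4)) * α₀))
      * ((L : ℝ) ^ j) ^ 2) * B₀ * ε < 1) (hε : 3 * ε ≤ b) (hε0 : 0 < ε)
    (hDball : ∀ B : S → 𝔸, ‖B‖ < ε → Dt B ∈ closedBall (0 : T → 𝔸)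
      (4 * ((8 * (131072 * ((d : ℝ) + 1) ^ 2) * Real.exp (4 * (800 * ((d : ℝ) + 1) ^ 2 * ((d : ℝ) + 4)) * α₀))
        * ((L : ℝ) ^ j) ^ 2) * ε ^ 2))
    (hDfix : ∀ B : S → 𝔸, ‖B‖ < ε → Cmap L U₀ S T j (B - hop (Dt B)) = Dt B) {A' : S → 𝔸} (hA : ‖A'‖ < ε) :
    DtN Dt A' 3 = D3 (C2map L U₀ S T j) (C3map L U₀ S T j) hop A' := by
  -- the tail constant of the series and the quartic constant of `eq56_order3_concrete`
  set K₁ : ℝ := 4 * ((8 * (131072 * ((d : ℝ) + 1) ^ 2) * Real.exp (4 * (800 * ((d : ℝ) + 1) ^ 2 * ((d : ℝ) + 4)) * α₀))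
      * ((L : ℝ) ^ j) ^ 2) * ε ^ 2 * 2 with hK₁
  obtain ⟨K'', hK''⟩ : ∃ K'' : ℝ, ∀ B : S → 𝔸, ‖B‖ < ε →
      ‖Dt B - (C2map L U₀ S T j B B + D3 (C2map L U₀ S T j) (C3map L U₀ S T j) hop B)‖ ≤ K'' * ‖B‖ ^ 4 :=
    ⟨_, fun B hB => eq56_order3_concrete L hL hG k U₀ hU₀ hα hα3 hα4 h52 hb hsmall hc₃ h145 h155 S T hop hj hB₀ hHop hB hq hε
      (hDball B hB) (hDfix B hB)⟩
  set E : T → 𝔸 := DtN Dt A' 3 - D3 (C2map L U₀ S T j) (C3map L U₀ S T j) hop A' with hE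
  refine sub_eq_zero.mp (eq_zero_of_pow_mul_norm_le (K := K₁ + K'' * ‖A'‖ ^ 4) 3 fun t ht0 ht1 => ?_)
  have htc : ‖(t : ℂ)‖ = t := by rw [Complex.norm_real, Real.norm_eq_abs, abs_of_pos ht0]
  -- the point `tA′` is in the ball, with `‖tA′‖/ε ≤ t ≤ 1/2`
  have htA : ‖(t : ℂ) • A'‖ = t * ‖A'‖ := by rw [norm_smul, htc]
  have htAε : ‖(t : ℂ) • A'‖ < ε := by
    rw [htA]
    calc t * ‖A'‖ ≤ 1 / 2 * ‖A'‖ := mul_le_mul_of_nonneg_right ht1 (norm_nonneg _)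
      _ < ε := by linarith [norm_nonneg A']
  have hρ : ‖(t : ℂ) • A'‖ / ε ≤ t := by
    rw [htA, div_le_iff₀ hε0]
    exact mul_le_mul_of_nonneg_left hA.le ht0.le
  have hρ' : ‖(t : ℂ) • A'‖ / ε ≤ 1 / 2 := hρ.trans ht1
  have hρ0 : 0 ≤ ‖(t : ℂ) • A'‖ / ε := div_nonneg (norm_nonneg _) hε0.le
  -- (i) the series (56) at `tA′` to order three: `‖D̃(tA′) − (t²C2map A′ A′ + t³D̃⁽³⁾(A′))‖ ≤ K₁t⁴`
  have h1 : ‖Dt ((t : ℂ) • A') - ((t : ℂ) ^ 2 • C2map L U₀ S T j A' A' + (t : ℂ) ^ 3 • DtN Dt A' 3)‖ ≤ K₁ * t ^ 4 := by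
    have htail := norm_Dt_sub_partialSum_le L hL hG k U₀ hU₀ hα hα3 hα4 h52 hb hsmall hc₃ S T hop hj hB₀ hHop hq hε hε0 hDball
      hDfix htAε 4
    have hsum : ∑ n ∈ Finset.range 4, DtN Dt ((t : ℂ) • A') n =
        (t : ℂ) ^ 2 • C2map L U₀ S T j A' A' + (t : ℂ) ^ 3 • DtN Dt A' 3 := by
      rw [Finset.sum_range_succ, Finset.sum_range_succ, Finset.sum_range_succ, Finset.sum_range_succ, Finset.sum_range_zero,
        DtN_zero L hL hG k U₀ hU₀ hα hα3 hα4 h52 hb hsmall hc₃ S T hop hj hB₀ hHop hq hε hε0 hDball hDfix,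
        DtN_one L hL hG k U₀ hU₀ hα hα3 hα4 h52 hb hsmall hc₃ S T hop hj hB₀ hHop hq hε hε0 hDball hDfix,
        DtN_smul L hL hG k U₀ hU₀ hα hα3 hα4 h52 hb hsmall hc₃ S T hop hj hB₀ hHop hq hε hε0 hDball hDfix A' (t : ℂ) 2,
        DtN_smul L hL hG k U₀ hU₀ hα hα3 hα4 h52 hb hsmall hc₃ S T hop hj hB₀ hHop hq hε hε0 hDball hDfix A' (t : ℂ) 3,
        DtN_two L hL hG k U₀ hU₀ hα hα3 hα4 h52 hb hsmall hc₃ h145 h155 S T hop hj hB₀ hHop hq hε hε0 hDball hDfix hA]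
      simp
    rw [hsum] at htail
    refine htail.trans ?_
    have hgeo : (1 - ‖(t : ℂ) • A'‖ / ε)⁻¹ ≤ 2 := by
      rw [inv_le_comm₀ (by linarith) (by norm_num : (0 : ℝ) < 2)]
      linarith
    have h4 : (‖(t : ℂ) • A'‖ / ε) ^ 4 ≤ t ^ 4 := pow_le_pow_left₀ hρ0 hρ 4
    calc 4 * ((8 * (131072 * ((d : ℝ) + 1) ^ 2) * Real.exp (4 * (800 * ((d : ℝ) + 1) ^ 2 * ((d : ℝ) + 4)) * α₀))
            * ((L : ℝ) ^ j) ^ 2) * ε ^ 2 * (‖(t : ℂ) • A'‖ / ε) ^ 4 * (1 - ‖(t : ℂ) • A'‖ / ε)⁻¹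
        ≤ 4 * ((8 * (131072 * ((d : ℝ) + 1) ^ 2) * Real.exp (4 * (800 * ((d : ℝ) + 1) ^ 2 * ((d : ℝ) + 4)) * α₀))
            * ((L : ℝ) ^ j) ^ 2) * ε ^ 2 * t ^ 4 * 2 := by
          exact mul_le_mul (mul_le_mul_of_nonneg_left h4 (by positivity)) hgeo (inv_nonneg.2 (by linarith)) (by positivity)
      _ = K₁ * t ^ 4 := by rw [hK₁]; ring
  -- (ii) the order-three remainder at `tA′`: `‖D̃(tA′) − (t²C2map A′ A′ + t³D3 A′)‖ ≤ K″‖A′‖⁴t⁴`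
  have h2 : ‖Dt ((t : ℂ) • A') - ((t : ℂ) ^ 2 • C2map L U₀ S T j A' A'
      + (t : ℂ) ^ 3 • D3 (C2map L U₀ S T j) (C3map L U₀ S T j) hop A')‖ ≤ K'' * ‖A'‖ ^ 4 * t ^ 4 := by
    have h56 := hK'' _ htAε
    have hbil : C2map L U₀ S T j ((t : ℂ) • A') ((t : ℂ) • A') = (t : ℂ) ^ 2 • C2map L U₀ S T j A' A' := by
      rw [LinearMap.map_smul₂, LinearMap.map_smul, smul_smul, pow_two]
    rw [hbil, D3_smul] at h56
    refine h56.trans (le_of_eq ?_)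
    rw [htA]
    ring
  -- (iii) subtract
  have hdiff : (t : ℂ) ^ 3 • E =
      (Dt ((t : ℂ) • A') - ((t : ℂ) ^ 2 • C2map L U₀ S T j A' A'
        + (t : ℂ) ^ 3 • D3 (C2map L U₀ S T j) (C3map L U₀ S T j) hop A'))
      - (Dt ((t : ℂ) • A') - ((t : ℂ) ^ 2 • C2map L U₀ S T j A' A' + (t : ℂ) ^ 3 • DtN Dt A' 3)) := by
    rw [hE, smul_sub]; abel
  have hnorm : ‖(t : ℂ) ^ 3 • E‖ = t ^ 3 * ‖E‖ := by rw [norm_smul, norm_pow, htc]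
  calc t ^ 3 * ‖E‖ = ‖(t : ℂ) ^ 3 • E‖ := hnorm.symm
    _ ≤ ‖Dt ((t : ℂ) • A') - ((t : ℂ) ^ 2 • C2map L U₀ S T j A' A'
          + (t : ℂ) ^ 3 • D3 (C2map L U₀ S T j) (C3map L U₀ S T j) hop A')‖
        + ‖Dt ((t : ℂ) • A') - ((t : ℂ) ^ 2 • C2map L U₀ S T j A' A' + (t : ℂ) ^ 3 • DtN Dt A' 3)‖ := by
        rw [hdiff]; exact norm_sub_le _ _
    _ ≤ K'' * ‖A'‖ ^ 4 * t ^ 4 + K₁ * t ^ 4 := add_le_add h2 h1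
    _ = (K₁ + K'' * ‖A'‖ ^ 4) * t ^ (3 + 1) := by ring

include hL hG hU₀ hα hα3 hα4 h52 hb hsmall hc₃ h145 h155 in
/-- **`D̃⁽³⁾(A′) = D^{(3)}(A′)` FOR EVERY `A′ ∈ 𝔸^S`** — both sides are homogeneous of order three (`DtN_smul`, `D3_smul`; «homogeneous polynomials of
n-th order»), so the identity on the ball (`DtN_three_of_norm_lt` at `sA′`, `s = ε/(2(‖A′‖ + 1))`) propagates. [cite: Balaban1985Variational, (56) p.286] -/
theorem DtN_three {j : ℕ} (hj : j ≤ k) (hB₀ : 0 ≤ B₀) (hHop : ∀ X, ‖hop X‖ ≤ B₀ * ‖X‖)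
    (hq : 9 * ((8 * (131072 * ((d : ℝ) + 1) ^ 2) * Real.exp (4 * (800 * ((d : ℝ) + 1) ^ 2 * ((d : ℝ) + 4)) * α₀))
      * ((L : ℝ) ^ j) ^ 2) * B₀ * ε < 1) (hε : 3 * ε ≤ b) (hε0 : 0 < ε)
    (hDball : ∀ B : S → 𝔸, ‖B‖ < ε → Dt B ∈ closedBall (0 : T → 𝔸)
      (4 * ((8 * (131072 * ((d : ℝ) + 1) ^ 2) * Real.exp (4 * (800 * ((d : ℝ) + 1) ^ 2 * ((d : ℝ) + 4)) * α₀))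
        * ((L : ℝ) ^ j) ^ 2) * ε ^ 2))
    (hDfix : ∀ B : S → 𝔸, ‖B‖ < ε → Cmap L U₀ S T j (B - hop (Dt B)) = Dt B) (A' : S → 𝔸) :
    DtN Dt A' 3 = D3 (C2map L U₀ S T j) (C3map L U₀ S T j) hop A' := by
  -- a real scale `s > 0` with `‖sA′‖ < ε`
  set s : ℝ := ε / (2 * (‖A'‖ + 1)) with hs
  have hA1 : 0 < ‖A'‖ + 1 := by positivity
  have hs0 : 0 < s := div_pos hε0 (by positivity)
  have hsc : ‖(s : ℂ)‖ = s := by rw [Complex.norm_real, Real.norm_eq_abs, abs_of_pos hs0]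
  have hsA : ‖(s : ℂ) • A'‖ < ε := by
    rw [norm_smul, hsc]
    have h1 : s * ‖A'‖ ≤ s * (‖A'‖ + 1) := mul_le_mul_of_nonneg_left (by linarith) hs0.le
    have h2 : s * (‖A'‖ + 1) = ε / 2 := by rw [hs]; field_simp
    linarith
  have h := DtN_three_of_norm_lt L hL hG k U₀ hU₀ hα hα3 hα4 h52 hb hsmall hc₃ h145 h155 S T hop hj hB₀ hHop hq hε hε0 hDball hDfix hsA
  rw [DtN_smul L hL hG k U₀ hU₀ hα hα3 hα4 h52 hb hsmall hc₃ S T hop hj hB₀ hHop hq hε hε0 hDball hDfix A' (s : ℂ) 3, D3_smul] at h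
  have hs3 : (s : ℂ) ^ 3 ≠ 0 := pow_ne_zero 3 (by exact_mod_cast hs0.ne')
  exact smul_right_injective (T → 𝔸) hs3 h

include hL hG hU₀ hα hα3 hα4 h52 hb hsmall hc₃ h145 h155 in
/-- `D̃⁽³⁾(A′)` unfolded to the printed words: `D̃⁽³⁾(A′) = C3map A′ A′ A′ − 2•C2map A′ (H(C2map A′ A′))` — «D^{(3)}(A′) = C_j^{(3)}(LʲηA′) −
2C_j^{(2)}(LʲηA′, LʲηHC^{(2)}(A′))», every `A′ ∈ 𝔸^S`. [cite: Balaban1985Variational, (56) p.286] -/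
theorem DtN_three_eq {j : ℕ} (hj : j ≤ k) (hB₀ : 0 ≤ B₀) (hHop : ∀ X, ‖hop X‖ ≤ B₀ * ‖X‖)
    (hq : 9 * ((8 * (131072 * ((d : ℝ) + 1) ^ 2) * Real.exp (4 * (800 * ((d : ℝ) + 1) ^ 2 * ((d : ℝ) + 4)) * α₀))
      * ((L : ℝ) ^ j) ^ 2) * B₀ * ε < 1) (hε : 3 * ε ≤ b) (hε0 : 0 < ε)
    (hDball : ∀ B : S → 𝔸, ‖B‖ < ε → Dt B ∈ closedBall (0 : T → 𝔸)
      (4 * ((8 * (131072 * ((d : ℝ) + 1) ^ 2) * Real.exp (4 * (800 * ((d : ℝ) + 1) ^ 2 * ((d : ℝ) + 4)) * α₀))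
        * ((L : ℝ) ^ j) ^ 2) * ε ^ 2))
    (hDfix : ∀ B : S → 𝔸, ‖B‖ < ε → Cmap L U₀ S T j (B - hop (Dt B)) = Dt B) (A' : S → 𝔸) :
    DtN Dt A' 3 = C3map L U₀ S T j A' A' A' - (2 : ℕ) • C2map L U₀ S T j A' (hop (C2map L U₀ S T j A' A')) := by
  rw [DtN_three L hL hG k U₀ hU₀ hα hα3 hα4 h52 hb hsmall hc₃ h145 h155 S T hop hj hB₀ hHop hq hε hε0 hDball hDfix A', D3_def]

include hL hG hU₀ hα hα3 hα4 h52 hb hsmall hc₃ h145 h155 in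
/-- **`D̃⁽²⁾(A′) = C⁽²⁾(A′, A′)` FOR EVERY `A′ ∈ 𝔸^S`** — the gen-6 `B11Eq56SeriesConcrete.DtN_two` (stated on the ball (51)) extended to the whole space
by 2-homogeneity of both sides («For example we have on Λ_j D^{(2)}(A′) = C_j^{(2)}(LʲηA′)» and «C^{(2)}(A′) = C_j^{(2)}(LʲηA′) on Λ_j», p. 286;
«homogeneous polynomials»).
[cite: Balaban1985Variational, (56) p.286] [cite: Balaban1985Averaging, (136) p.39] -/
theorem DtN_two_all {j : ℕ} (hj : j ≤ k) (hB₀ : 0 ≤ B₀) (hHop : ∀ X, ‖hop X‖ ≤ B₀ * ‖X‖)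
    (hq : 9 * ((8 * (131072 * ((d : ℝ) + 1) ^ 2) * Real.exp (4 * (800 * ((d : ℝ) + 1) ^ 2 * ((d : ℝ) + 4)) * α₀))
      * ((L : ℝ) ^ j) ^ 2) * B₀ * ε < 1) (hε : 3 * ε ≤ b) (hε0 : 0 < ε)
    (hDball : ∀ B : S → 𝔸, ‖B‖ < ε → Dt B ∈ closedBall (0 : T → 𝔸)
      (4 * ((8 * (131072 * ((d : ℝ) + 1) ^ 2) * Real.exp (4 * (800 * ((d : ℝ) + 1) ^ 2 * ((d : ℝ) + 4)) * α₀))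
        * ((L : ℝ) ^ j) ^ 2) * ε ^ 2))
    (hDfix : ∀ B : S → 𝔸, ‖B‖ < ε → Cmap L U₀ S T j (B - hop (Dt B)) = Dt B) (A' : S → 𝔸) :
    DtN Dt A' 2 = C2map L U₀ S T j A' A' := by
  set s : ℝ := ε / (2 * (‖A'‖ + 1)) with hs
  have hA1 : 0 < ‖A'‖ + 1 := by positivity
  have hs0 : 0 < s := div_pos hε0 (by positivity)
  have hsc : ‖(s : ℂ)‖ = s := by rw [Complex.norm_real, Real.norm_eq_abs, abs_of_pos hs0]
  have hsA : ‖(s : ℂ) • A'‖ < ε := by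
    rw [norm_smul, hsc]
    have h1 : s * ‖A'‖ ≤ s * (‖A'‖ + 1) := mul_le_mul_of_nonneg_left (by linarith) hs0.le
    have h2 : s * (‖A'‖ + 1) = ε / 2 := by rw [hs]; field_simp
    linarith
  have h := DtN_two L hL hG k U₀ hU₀ hα hα3 hα4 h52 hb hsmall hc₃ h145 h155 S T hop hj hB₀ hHop hq hε hε0 hDball hDfix hsA
  have hbil : C2map L U₀ S T j ((s : ℂ) • A') ((s : ℂ) • A') = (s : ℂ) ^ 2 • C2map L U₀ S T j A' A' := by
    rw [LinearMap.map_smul₂, LinearMap.map_smul, smul_smul, pow_two]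
  rw [DtN_smul L hL hG k U₀ hU₀ hα hα3 hα4 h52 hb hsmall hc₃ S T hop hj hB₀ hHop hq hε hε0 hDball hDfix A' (s : ℂ) 2, hbil] at h
  have hs2 : (s : ℂ) ^ 2 ≠ 0 := pow_ne_zero 2 (by exact_mod_cast hs0.ne')
  exact smul_right_injective (T → 𝔸) hs2 h

end Regime

/-! ## §2 The terms of any power series of `D̃` at `0` are the `D̃⁽ⁿ⁾` -/

section Bridge

variable {𝔸 : Type*} [NormedRing 𝔸] [NormedAlgebra ℂ 𝔸] [CompleteSpace 𝔸] {S T : Finset (Site d × Fin d)}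

/-- **THE `n`-TH TERM OF ANY POWER SERIES OF `D̃` AT `0`, ON THE DIAGONAL, IS `D̃⁽ⁿ⁾`**: `p_n(A′, …, A′) = DtN Dt A′ n` — the homogeneous polynomials
«D^{(n)}» of (56) are intrinsic (no regime hypothesis; `B11Eq56Coefficients.powerSeries_Dt_diag_eq_slice_coeff` and the definition of `DtN`).
[cite: Balaban1985Variational, (56) p.286] -/
theorem powerSeries_Dt_diag_eq_DtN {Dt : (S → 𝔸) → (T → 𝔸)} {p : FormalMultilinearSeries ℂ (S → 𝔸) (T → 𝔸)}
    (hp : HasFPowerSeriesAt Dt p 0) (A' : S → 𝔸) (n : ℕ) :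
    p n (fun _ => A') = DtN Dt A' n := by
  rw [DtN_def]
  exact powerSeries_Dt_diag_eq_slice_coeff hp A' n

end Bridge

section RegimeBridge

variable {𝔸 : Type*} [NormedRing 𝔸] [NormedAlgebra ℂ 𝔸] [CompleteSpace 𝔸] [NormOneClass 𝔸]

variable (L : ℕ) (hL : 2 ≤ L) {G : Subgroup 𝔸ˣ} (hG : AvgClosed d L G) (k : ℕ)
  (U₀ : Site d → Fin d → 𝔸ˣ) (hU₀ : ∀ x κ, U₀ x κ ∈ G) {α₀ : ℝ} (hα : 0 < α₀)
  (hα3 : C0 d * α₀ ≤ 1 / 3) (hα4 : 4 * α₀ ≤ c2' d L) (h52 : pdev U₀ < α₀ * (((L : ℝ) ^ k)⁻¹) ^ 2)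
  {b : ℝ} (hb : 0 < b)
  (hsmall : Real.exp (4 * (800 * ((d : ℝ) + 1) ^ 2 * ((d : ℝ) + 4)) * α₀)
    * (1 + 8 * (131072 * ((d : ℝ) + 1) ^ 2) * ((L : ℝ) ^ k * b)) ≤ 2)
  (hc₃ : 4 * ((L : ℝ) ^ k * b) < c3 d L)
  (h145 : 8 * d * thetaGen d L α₀ * (L : ℝ)⁻¹ ^ 4 ≤ 1)
  (h155 : (2 * (L : ℝ) - 1) * (L : ℝ)⁻¹ ^ 2 + 2 * d * thetaGen d L α₀ * (L : ℝ)⁻¹ ^ 3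
    + 1 / 8 * (1 + 2 * d * thetaGen d L α₀ * (L : ℝ)⁻¹ ^ 2 + 2 * d * C3Gen d L * ((L : ℝ) ^ k * b)) * (L : ℝ)⁻¹ ^ 2 ≤ 1)
  (S T : Finset (Site d × Fin d)) (hop : (T → 𝔸) →ₗ[ℂ] (S → 𝔸)) {B₀ ε : ℝ} {Dt : (S → 𝔸) → (T → 𝔸)}

include hL hG hU₀ hα hα3 hα4 h52 hb hsmall hc₃ h145 h155 in
/-- **`p₃(A′, A′, A′) = D^{(3)}(A′)` FOR EVERY POWER SERIES OF THE CONCRETE `D̃`**: if `p` is a power series at `0` of a map `D̃` with the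
fixed-point characterization (49) + (55)-ball on `‖A′‖ < ε`, then `p₃(A′, A′, A′) = C3map A′ A′ A′ − 2•C2map A′ (H(C2map A′ A′))` for every
`A′ ∈ 𝔸^S`. [cite: Balaban1985Variational, (56) p.286] -/
theorem powerSeries_Dt_diag_three {j : ℕ} (hj : j ≤ k) (hB₀ : 0 ≤ B₀) (hHop : ∀ X, ‖hop X‖ ≤ B₀ * ‖X‖)
    (hq : 9 * ((8 * (131072 * ((d : ℝ) + 1) ^ 2) * Real.exp (4 * (800 * ((d : ℝ) + 1) ^ 2 * ((d : ℝ) + 4)) * α₀))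
      * ((L : ℝ) ^ j) ^ 2) * B₀ * ε < 1) (hε : 3 * ε ≤ b) (hε0 : 0 < ε)
    (hDball : ∀ B : S → 𝔸, ‖B‖ < ε → Dt B ∈ closedBall (0 : T → 𝔸)
      (4 * ((8 * (131072 * ((d : ℝ) + 1) ^ 2) * Real.exp (4 * (800 * ((d : ℝ) + 1) ^ 2 * ((d : ℝ) + 4)) * α₀))
        * ((L : ℝ) ^ j) ^ 2) * ε ^ 2))
    (hDfix : ∀ B : S → 𝔸, ‖B‖ < ε → Cmap L U₀ S T j (B - hop (Dt B)) = Dt B)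
    {p : FormalMultilinearSeries ℂ (S → 𝔸) (T → 𝔸)} (hp : HasFPowerSeriesAt Dt p 0) (A' : S → 𝔸) :
    p 3 (fun _ => A') = D3 (C2map L U₀ S T j) (C3map L U₀ S T j) hop A' := by
  rw [powerSeries_Dt_diag_eq_DtN hp A' 3]
  exact DtN_three L hL hG k U₀ hU₀ hα hα3 hα4 h52 hb hsmall hc₃ h145 h155 S T hop hj hB₀ hHop hq hε hε0 hDball hDfix A'

include hL hG hU₀ hα hα3 hα4 h52 hb hsmall hc₃ h145 h155 in
/-- **(55)–(56) IN POWER-SERIES LANGUAGE WITH BOTH PRINTED TERMS NAMED, FOR THE CONCRETE `D̃`**: a power series `p` of `D̃` at `0` with `p₀ = 0`,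
`p₁ = 0`, `p₂(A′, A′) = C2map A′ A′`, `p₃(A′, A′, A′) = C3map A′ A′ A′ − 2•C2map A′ (H(C2map A′ A′))` and `p_n(A′, …, A′) = D̃⁽ⁿ⁾(A′)` for every `n`
(`B11Eq56Coefficients.p267_powerSeries_terms` with the third term added). [cite: Balaban1985Variational, (55)–(56) p.286, (54) p.286] -/
theorem p267_powerSeries_terms₃ {j : ℕ} (hj : j ≤ k) (hB₀ : 0 ≤ B₀) (hHop : ∀ X, ‖hop X‖ ≤ B₀ * ‖X‖)
    (hq : 9 * ((8 * (131072 * ((d : ℝ) + 1) ^ 2) * Real.exp (4 * (800 * ((d : ℝ) + 1) ^ 2 * ((d : ℝ) + 4)) * α₀))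
      * ((L : ℝ) ^ j) ^ 2) * B₀ * ε < 1) (hε : 3 * ε ≤ b) (hε0 : 0 < ε)
    (hDball : ∀ B : S → 𝔸, ‖B‖ < ε → Dt B ∈ closedBall (0 : T → 𝔸)
      (4 * ((8 * (131072 * ((d : ℝ) + 1) ^ 2) * Real.exp (4 * (800 * ((d : ℝ) + 1) ^ 2 * ((d : ℝ) + 4)) * α₀))
        * ((L : ℝ) ^ j) ^ 2) * ε ^ 2))
    (hDfix : ∀ B : S → 𝔸, ‖B‖ < ε → Cmap L U₀ S T j (B - hop (Dt B)) = Dt B) :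
    ∃ p : FormalMultilinearSeries ℂ (S → 𝔸) (T → 𝔸),
      HasFPowerSeriesAt Dt p 0 ∧ p 0 = 0 ∧ p 1 = 0 ∧
        ∀ A' : S → 𝔸, p 2 (fun _ => A') = C2map L U₀ S T j A' A' ∧
          p 3 (fun _ => A') = D3 (C2map L U₀ S T j) (C3map L U₀ S T j) hop A' ∧
          ∀ n : ℕ, p n (fun _ => A') = DtN Dt A' n := by
  obtain ⟨p, hp, h0, h1, hterms⟩ :=
    p267_powerSeries_terms L hL hG k U₀ hU₀ hα hα3 hα4 h52 hb hsmall hc₃ S T hop hj hB₀ hHop hq hε hε0 hDball hDfix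
  exact ⟨p, hp, h0, h1, fun A' => ⟨(hterms A').1,
    powerSeries_Dt_diag_three L hL hG k U₀ hU₀ hα hα3 hα4 h52 hb hsmall hc₃ h145 h155 S T hop hj hB₀ hHop hq hε hε0 hDball hDfix hp A',
    fun n => powerSeries_Dt_diag_eq_DtN hp A' n⟩⟩

/-! ## §3 (56) with its two printed terms separated: `D̃ = C⁽²⁾ + D⁽³⁾ + Σ_{n≥4} D̃⁽ⁿ⁾` -/

include hL hG hU₀ hα hα3 hα4 h52 hb hsmall hc₃ h145 h155 in
/-- the first four terms of (56) are `0 + 0 + C⁽²⁾(A′) + D⁽³⁾(A′)`: `Σ_{n<4} D̃⁽ⁿ⁾(A′) = C2map A′ A′ + D3 C2map C3map H A′`, every `A′ ∈ 𝔸^S`.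
[cite: Balaban1985Variational, (55)–(56) p.286] -/
theorem sum_range_four_DtN {j : ℕ} (hj : j ≤ k) (hB₀ : 0 ≤ B₀) (hHop : ∀ X, ‖hop X‖ ≤ B₀ * ‖X‖)
    (hq : 9 * ((8 * (131072 * ((d : ℝ) + 1) ^ 2) * Real.exp (4 * (800 * ((d : ℝ) + 1) ^ 2 * ((d : ℝ) + 4)) * α₀))
      * ((L : ℝ) ^ j) ^ 2) * B₀ * ε < 1) (hε : 3 * ε ≤ b) (hε0 : 0 < ε)
    (hDball : ∀ B : S → 𝔸, ‖B‖ < ε → Dt B ∈ closedBall (0 : T → 𝔸)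
      (4 * ((8 * (131072 * ((d : ℝ) + 1) ^ 2) * Real.exp (4 * (800 * ((d : ℝ) + 1) ^ 2 * ((d : ℝ) + 4)) * α₀))
        * ((L : ℝ) ^ j) ^ 2) * ε ^ 2))
    (hDfix : ∀ B : S → 𝔸, ‖B‖ < ε → Cmap L U₀ S T j (B - hop (Dt B)) = Dt B) (A' : S → 𝔸) :
    ∑ n ∈ Finset.range 4, DtN Dt A' n = C2map L U₀ S T j A' A' + D3 (C2map L U₀ S T j) (C3map L U₀ S T j) hop A' := by
  rw [Finset.sum_range_succ, Finset.sum_range_succ, Finset.sum_range_succ, Finset.sum_range_succ, Finset.sum_range_zero,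
    DtN_zero L hL hG k U₀ hU₀ hα hα3 hα4 h52 hb hsmall hc₃ S T hop hj hB₀ hHop hq hε hε0 hDball hDfix,
    DtN_one L hL hG k U₀ hU₀ hα hα3 hα4 h52 hb hsmall hc₃ S T hop hj hB₀ hHop hq hε hε0 hDball hDfix,
    DtN_two_all L hL hG k U₀ hU₀ hα hα3 hα4 h52 hb hsmall hc₃ h145 h155 S T hop hj hB₀ hHop hq hε hε0 hDball hDfix A',
    DtN_three L hL hG k U₀ hU₀ hα hα3 hα4 h52 hb hsmall hc₃ h145 h155 S T hop hj hB₀ hHop hq hε hε0 hDball hDfix A']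
  simp

include hL hG hU₀ hα hα3 hα4 h52 hb hsmall hc₃ h145 h155 in
/-- **THE QUARTIC REMAINDER OF (56) AFTER ITS TWO PRINTED TERMS, ON THE WHOLE BALL (51)**: for `‖A′‖ < ε`, `‖D̃(A′) − (C⁽²⁾(A′) + D⁽³⁾(A′))‖ ≤
4C₂(Lʲ)²ε²·(‖A′‖/ε)⁴·(1 − ‖A′‖/ε)⁻¹` (`norm_Dt_sub_partialSum_le` at `N = 4`, terms identified). [cite: Balaban1985Variational, (56) p.286] -/
theorem norm_Dt_sub_D2_sub_D3_le {j : ℕ} (hj : j ≤ k) (hB₀ : 0 ≤ B₀) (hHop : ∀ X, ‖hop X‖ ≤ B₀ * ‖X‖)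
    (hq : 9 * ((8 * (131072 * ((d : ℝ) + 1) ^ 2) * Real.exp (4 * (800 * ((d : ℝ) + 1) ^ 2 * ((d : ℝ) + 4)) * α₀))
      * ((L : ℝ) ^ j) ^ 2) * B₀ * ε < 1) (hε : 3 * ε ≤ b) (hε0 : 0 < ε)
    (hDball : ∀ B : S → 𝔸, ‖B‖ < ε → Dt B ∈ closedBall (0 : T → 𝔸)
      (4 * ((8 * (131072 * ((d : ℝ) + 1) ^ 2) * Real.exp (4 * (800 * ((d : ℝ) + 1) ^ 2 * ((d : ℝ) + 4)) * α₀))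
        * ((L : ℝ) ^ j) ^ 2) * ε ^ 2))
    (hDfix : ∀ B : S → 𝔸, ‖B‖ < ε → Cmap L U₀ S T j (B - hop (Dt B)) = Dt B) {A' : S → 𝔸} (hA : ‖A'‖ < ε) :
    ‖Dt A' - (C2map L U₀ S T j A' A' + D3 (C2map L U₀ S T j) (C3map L U₀ S T j) hop A')‖ ≤
      4 * ((8 * (131072 * ((d : ℝ) + 1) ^ 2) * Real.exp (4 * (800 * ((d : ℝ) + 1) ^ 2 * ((d : ℝ) + 4)) * α₀))
        * ((L : ℝ) ^ j) ^ 2) * ε ^ 2 * (‖A'‖ / ε) ^ 4 * (1 - ‖A'‖ / ε)⁻¹ := by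
  rw [← sum_range_four_DtN L hL hG k U₀ hU₀ hα hα3 hα4 h52 hb hsmall hc₃ h145 h155 S T hop hj hB₀ hHop hq hε hε0 hDball hDfix A']
  exact norm_Dt_sub_partialSum_le L hL hG k U₀ hU₀ hα hα3 hα4 h52 hb hsmall hc₃ S T hop hj hB₀ hHop hq hε hε0 hDball hDfix hA 4

include hL hG hU₀ hα hα3 hα4 h52 hb hsmall hc₃ h145 h155 in
/-- **«AND SO ON»**: for `‖A′‖ < ε`, `Σ_{n≥0} D̃⁽ⁿ⁺⁴⁾(A′) = D̃(A′) − (C⁽²⁾(A′) + D⁽³⁾(A′))` (`hasSum_DtN`, first four terms split off).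
[cite: Balaban1985Variational, (56) p.286] -/
theorem hasSum_DtN_from_four {j : ℕ} (hj : j ≤ k) (hB₀ : 0 ≤ B₀) (hHop : ∀ X, ‖hop X‖ ≤ B₀ * ‖X‖)
    (hq : 9 * ((8 * (131072 * ((d : ℝ) + 1) ^ 2) * Real.exp (4 * (800 * ((d : ℝ) + 1) ^ 2 * ((d : ℝ) + 4)) * α₀))
      * ((L : ℝ) ^ j) ^ 2) * B₀ * ε < 1) (hε : 3 * ε ≤ b) (hε0 : 0 < ε)
    (hDball : ∀ B : S → 𝔸, ‖B‖ < ε → Dt B ∈ closedBall (0 : T → 𝔸)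
      (4 * ((8 * (131072 * ((d : ℝ) + 1) ^ 2) * Real.exp (4 * (800 * ((d : ℝ) + 1) ^ 2 * ((d : ℝ) + 4)) * α₀))
        * ((L : ℝ) ^ j) ^ 2) * ε ^ 2))
    (hDfix : ∀ B : S → 𝔸, ‖B‖ < ε → Cmap L U₀ S T j (B - hop (Dt B)) = Dt B) {A' : S → 𝔸} (hA : ‖A'‖ < ε) :
    HasSum (fun n : ℕ => DtN Dt A' (n + 4))
      (Dt A' - (C2map L U₀ S T j A' A' + D3 (C2map L U₀ S T j) (C3map L U₀ S T j) hop A')) := by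
  rw [← sum_range_four_DtN L hL hG k U₀ hU₀ hα hα3 hα4 h52 hb hsmall hc₃ h145 h155 S T hop hj hB₀ hHop hq hε hε0 hDball hDfix A']
  exact (hasSum_nat_add_iff' 4).2
    (hasSum_DtN L hL hG k U₀ hU₀ hα hα3 hα4 h52 hb hsmall hc₃ S T hop hj hB₀ hHop hq hε hε0 hDball hDfix hA)

end RegimeBridge

end Literature.MathematicalPhysics.QuantumFieldTheory.Balaban1983to89.B11Eq56ThirdTermConcrete

end
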